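import Summits.Ventures.QEC.Census.LRATBridge
import Summits.Ventures.QEC.Census.CertBits
import HarnessLib

/-!
# Kernel-B certificates: completeness of the logical basis (`hlog`) from rank certificates

Cell `qec`, PARTITION v2 row type-11 — the K1/K2-common linear-algebra step the kernel-B (SAT) route
needs and the kernel-A routes do not: the CNF `Q_any(H, L, w)` asserts «`⟨L_j, v⟩ = 1` for SOME `j`», so
turning its refutation into «no logical of weight `≤ w`» requires that every logical `v` (`H v = 0`,
`v ∉ rs H_other`) meets some `L_j` oddly — hypothesis `hlog` of `LRATBridge.le_dX_of_unsat…` /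
`LRATLeaves…`.  Here `hlog` is derived from two rank LOWER bounds checkable by `decide` on bitmask data:

* `pcCode_le_rowSpace_of_rank` (generic): `M Bᵀ = 0`, `a ≤ rank M`, `b ≤ rank B`, `|Q| ≤ a + b`
  `⟹ ker M ≤ rs B` (dimension count: `dim ker M = |Q| − rank M ≤ rank B = dim rs B` and `rs B ≤ ker M`).
* `le_rank_maskMatrix`: `r ≤ rank` from `r` pivot rows with right-inverse masks
  (`|row_{π a} ∩ N_i| ≡ [a = i]`), the `≥` half of type-02's `rank_eq_of_pivots` (no spanning data needed).
* `hlog_of_rankCerts`: for bitmask rows `HX : Fin mX → ℕ`, `LX : Fin k → ℕ`, `HZ : Fin mZ → ℕ` over `n`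
  qubits: if every `HX`-row and every `LX_j` meets every `HZ`-row evenly (`M HZᵀ = 0`, `M := [HX; LX]`),
  `a ≤ rank M`, `b ≤ rank HZ` and `n ≤ a + b`, then every `v` with `HX v = 0`, `v ∉ rs HZ` has
  `⟨LX_j, v⟩ ≠ 0` for some `j`.
Matrices of bitmask rows: `maskMatrix n rows i j = ofBits n (rows i) j` (type-10's `CertBits.ofBits`; rows
indexed by `Fin r`, so that `C.HXFlat = maskMatrix n hx` is an `ext; decide` identity as in
`Census/BB/BB72Index.lean`).
-/

namespace Summit.Ventures.QEC.Census.LRATBridge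

open Matrix Literature.InformationTheory.QuantumCodes Summit.Ventures.QEC.Census

/-! ## Generic linear algebra -/

/-- **`ker M ≤ rs B` from ranks**: if `M Bᵀ = 0` (every row of `B` is in `ker M`), `a ≤ rank M`,
`b ≤ rank B` and `|Q| ≤ a + b`, then `ker M ≤ rs B` (indeed `=`). -/
theorem pcCode_le_rowSpace_of_rank {R R' Q : Type*} [Fintype R] [Fintype R'] [Fintype Q]
    [DecidableEq Q] (M : Matrix R Q (ZMod 2)) (B : Matrix R' Q (ZMod 2)) (h0 : M * Bᵀ = 0)
    {a b : ℕ} (ha : a ≤ M.rank) (hb : b ≤ B.rank) (hcard : Fintype.card Q ≤ a + b) :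
    pcCode M ≤ rowSpace B := by
  have hle : rowSpace B ≤ pcCode M := by
    intro v hv
    obtain ⟨c, rfl⟩ := (mem_rowSpace_iff B v).1 hv
    rw [mem_pcCode_iff, mulVec_vecMul, h0, zero_mulVec]
  have hdim : Module.finrank (ZMod 2) (pcCode M) ≤ Module.finrank (ZMod 2) (rowSpace B) := by
    have h1 := rank_add_finrank_pcCode M
    rw [finrank_rowSpace_eq_rank]
    omega
  rw [Submodule.eq_of_le_of_finrank_le hle hdim]

/-! ## Bitmask matrices and rank lower bounds -/

/-- The `𝔽₂`-matrix whose row `i` is the bitmask `rows i` (bit `j` = column `j < n`). -/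
def maskMatrix {r : ℕ} (n : ℕ) (rows : Fin r → ℕ) : Matrix (Fin r) (Fin n) (ZMod 2) :=
  fun i j => ofBits n (rows i) j

/-- Row `i` of `maskMatrix n rows` is `ofBits n (rows i)`. -/
theorem maskMatrix_row {r : ℕ} (n : ℕ) (rows : Fin r → ℕ) (i : Fin r) :
    maskMatrix n rows i = ofBits n (rows i) := rfl

/-- `maskMatrix n A * (maskMatrix n B)ᵀ = 0` from the parity table «every `A`-row meets every `B`-row
evenly» (bitwise, `decide`-able). -/
theorem maskMatrix_mul_transpose_eq_zero {r r' : ℕ} (n : ℕ) (A : Fin r → ℕ) (B : Fin r' → ℕ)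
    (h : ∀ i j, popc n (A i &&& B j) % 2 = 0) : maskMatrix n A * (maskMatrix n B)ᵀ = 0 := by
  ext i j
  rw [Matrix.mul_apply', Matrix.zero_apply]
  change ofBits n (A i) ⬝ᵥ ofBits n (B j) = 0
  rw [ofBits_dotProduct, natCast_zmod2_eq_zero_iff]
  exact h i j

/-- **Rank lower bound from pivots with right inverses**: if rows `π a` (`a < r`) of `maskMatrix n rows`
and masks `N i` satisfy `|rows (π a) ∩ N i| ≡ [a = i] (mod 2)`, then `r ≤ rank`. -/
theorem le_rank_maskMatrix {r r' : ℕ} (n : ℕ) (rows : Fin r' → ℕ) (piv : Fin r → Fin r') (N : Fin r → ℕ)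
    (h : ∀ a i : Fin r, popc n (rows (piv a) &&& N i) % 2 = if a = i then 1 else 0) :
    r ≤ (maskMatrix n rows).rank := by
  let Hsel : Matrix (Fin r) (Fin n) (ZMod 2) := (maskMatrix n rows).submatrix piv id
  let Nm : Matrix (Fin n) (Fin r) (ZMod 2) := Matrix.of fun q i => ofBits n (N i) q
  have h1 : Hsel * Nm = 1 := by
    ext a i
    rw [Matrix.mul_apply', Matrix.one_apply]
    change ofBits n (rows (piv a)) ⬝ᵥ ofBits n (N i) = _
    rw [ofBits_dotProduct, ← ZMod.natCast_mod (popc n _) 2, h a i]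
    by_cases hai : a = i <;> simp [hai]
  have h2 : r ≤ Hsel.rank := by
    have h := Matrix.rank_mul_le_left Hsel Nm
    rwa [h1, Matrix.rank_one, Fintype.card_fin] at h
  have h3 : Hsel.rank ≤ (maskMatrix n rows).rank := by
    rw [Matrix.rank_eq_finrank_span_row, Matrix.rank_eq_finrank_span_row]
    exact Submodule.finrank_mono (Submodule.span_mono (by rintro _ ⟨a, rfl⟩; exact ⟨piv a, rfl⟩))
  exact h2.trans h3

/-! ## `hlog` from rank certificates -/

/-- **Completeness of the logical basis from rank certificates.**  Bitmask data over `n` qubits: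
syndrome rows `HX`, logicals `LX`, stabilizer rows `HZ`.  If `[HX; LX] · HZᵀ = 0` (parity table `hcomm`),
`a ≤ rank [HX; LX]` and `b ≤ rank HZ` (pivot certificates, `le_rank_maskMatrix`) with `n ≤ a + b`, then
every `v` with `HX v = 0` and `v ∉ rs HZ` has `⟨LX_j, v⟩ ≠ 0` for some `j` — hypothesis `hlog` of the
kernel-B assembly theorems, for `H = maskMatrix n HX`, `R = rs (maskMatrix n HZ)`,
`L j = ofBits n (LX j)`. -/
theorem hlog_of_rankCerts {mX mZ k : ℕ} (n : ℕ) (HX : Fin mX → ℕ) (LX : Fin k → ℕ) (HZ : Fin mZ → ℕ)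
    (hcomm : ∀ i j, popc n (Fin.append HX LX i &&& HZ j) % 2 = 0)
    {a b : ℕ} (ha : a ≤ (maskMatrix n (Fin.append HX LX)).rank) (hb : b ≤ (maskMatrix n HZ).rank)
    (hcard : n ≤ a + b) (v : Fin n → ZMod 2) (hv : maskMatrix n HX *ᵥ v = 0)
    (hv' : v ∉ rowSpace (maskMatrix n HZ)) : ∃ j, ofBits n (LX j) ⬝ᵥ v ≠ 0 := by
  by_contra hnone
  apply hv'
  have hker : v ∈ pcCode (maskMatrix n (Fin.append HX LX)) := by
    rw [mem_pcCode_iff]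
    funext i
    rw [Pi.zero_apply, mulVec, maskMatrix_row]
    refine Fin.addCases (fun i => ?_) (fun j => ?_) i
    · rw [Fin.append_left]
      have := congrFun hv i
      rwa [Pi.zero_apply, mulVec, maskMatrix_row] at this
    · rw [Fin.append_right]
      by_contra hj
      exact hnone ⟨j, hj⟩
  exact pcCode_le_rowSpace_of_rank _ _ (maskMatrix_mul_transpose_eq_zero n _ _ hcomm) ha hb
    (by rwa [Fintype.card_fin]) hker

/-- The support list of a bitmask vector is its list of set bits below `n` (to discharge `hus` of the
assembly theorems from bitmask data by `decide`). -/
theorem support_ofBits (n w : ℕ) :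
    support (ofBits n w) = ((List.finRange n).filter fun i : Fin n => w.testBit i.val).map Fin.val := by
  simp only [support, ofBits]
  congr 1
  apply List.filter_congr
  intro i _
  by_cases h : w.testBit i <;> simp [h]

end Summit.Ventures.QEC.Census.LRATBridge
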